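import Summits.MatrixMultiplication.MatrixMultiplication.Theorems.OutsiderSandwichYield
import HarnessLib

/-!
# Amortised exchange: `⟨B⟩ ⊠ C₁^{⊠N} ⊵ ⟨m⟩ ⊠ ⟨2,2,2⟩^{⊠N}` and the leaf

Route `OutsiderSandwich` (decomposition cell `decomp-mm`, lens 4 «minimal counterexample /
extremal reduction», gen 28), support for the aside leaf `BlockOneIsMM`
(stmt-MatrixMultiplication-27147).

The exchange number `r(N) = min {B : ⟨B⟩ ⊠ C₁^{⊠N} ⊵ ⟨2,2,2⟩^{⊠N}}` (`Helped N B`) measures how many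
independent copies of the coupled Coppersmith–Winograd block `C₁` are needed to pay for `N`
Kronecker factors of `⟨2,2,2⟩`.  `OutsiderSandwichYield` exhibited the first certificate WITH
MULTIPLICITY on the product side, `⟨3⟩ ⊠ C₁ ⊵ ⟨2⟩ ⊠ ⟨2,2,2⟩` (amortised ratio `3/2 < 2 = r(1)`).
This file records what amortised certificates `⟨B⟩ ⊠ C₁^{⊠N} ⊵ ⟨m⟩ ⊠ ⟨2,2,2⟩^{⊠N}`
(restriction, or degeneration in the sense of BCS (15.19)) are worth for the leaf:

* `multiplicity one is the exchange number` (`restrictsTo_unitOne_iff_helped`);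
* `amortised certificates multiply` (`amortised_mul`): the set of triples `(N, B, m)` is a
  sub-semigroup, so `(1, 3, 2)` gives `(N, 3^N, 2^N)` for every `N`;
* at every universal spectral point `m · F⟨2,2,2⟩^N ≤ B · F(C₁)^N` (`spectral_of_amortised`), hence
  `SpectralRatioLe (log₂(B/m)/N)` and **`θ⋆ ≤ log₂(B/m)/N`** (`exchangeExponent_le_of_amortised`) —
  the amortised RATIO `B/m`, not `B`, is what bounds the exchange exponent;
* **a TIGHT amortised certificate at any level decides the leaf**: `⟨m⟩ ⊠ C₁^{⊠N} ⊵ ⟨m⟩ ⊠ ⟨2,2,2⟩^{⊠N}`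
  (even as a degeneration) for a single pair `N, m ≥ 1` implies `BlockOneIsMM`
  (`blockOneIsMM_of_tight`), whereas the leaf itself only asserts ratio `2^{o(N)}`;
* the multiplicity-one tight case is exactly the refuted `r(N) = 1` (`not_tight_one`, Kernel II).

So the node «∃ N m ≥ 1, ⟨m⟩ ⊠ C₁^{⊠N} ⊵ ⟨m⟩ ⊠ ⟨2,2,2⟩^{⊠N}» is a SUFFICIENT, strictly-typed
strengthening of the leaf whose smallest instances (`(N, m) = (1, 2), (1, 3), (2, 2)`: legs of
dimension `8, 12, 32`) are finite restriction problems.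

## References
* D. Coppersmith, S. Winograd, *Matrix multiplication via arithmetic progressions*,
  J. Symbolic Comput. 9 (1990) 251–280, §7. [CoppersmithWinograd1990]
* P. Bürgisser, M. Clausen, M. A. Shokrollahi, *Algebraic Complexity Theory*, Springer (1997),
  (15.19)–(15.20), Lemma 15.23. [BurgisserClausenShokrollahi1997]
* V. Strassen, *The asymptotic spectrum of tensors*, J. reine angew. Math. 384 (1988) 102–152,
  Thm. 3.8. [Strassen1988]
-/

noncomputable section

open scoped BigOperators

set_option linter.dupNamespace false
set_option autoImplicit false

namespace Summit.MatrixMultiplication.MatrixMultiplication.Theorems.OutsiderSandwichAmortised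

open Literature.Computability.AlgebraicComplexity
open Summit.MatrixMultiplication.MatrixMultiplication.Theorems.OutsiderSandwichCoupling (coupling₁)
open Summit.MatrixMultiplication.MatrixMultiplication.Theorems.OutsiderSandwichExchangeRate
  (Helped helped_iff_le not_helped_one)
open Summit.MatrixMultiplication.MatrixMultiplication.Theorems.OutsiderSandwichExchangeSpectral
  (SpectralRatioLe four_le_map_coupling₁ exchangeExponent_le_of_spectralRatioLe
    blockOneIsMM_iff_spectralRatioLe_zero)
open Summit.MatrixMultiplication.MatrixMultiplication.Theorems.OutsiderSandwichExchangeExponent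
  (exchangeExponent)

/-! ## 1. The semigroup of amortised certificates -/

/-- `[⟨B⟩ ⊠ t^{⊠N}] = B · [t]^N` in `T(ℂ)`. [cite: BurgisserClausenShokrollahi1997, (14.21)] -/
theorem mk_unit_kronecker_pow {ι κ μ : Type} [Fintype ι] [Fintype κ] [Fintype μ] [DecidableEq ι]
    [DecidableEq κ] [DecidableEq μ] (t : ι → κ → μ → ℂ) (B N : ℕ) :
    TensorClass.mk (kroneckerTensor (unitTensor ℂ B) (kroneckerPow t N)) =
      (B : TensorClass ℂ) * TensorClass.mk t ^ N := by
  rw [TensorClass.natCast_eq_mk, TensorClass.mk_pow, TensorClass.mk_mul_mk]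

/-- An amortised certificate is the inequality `m · [M]^N ≤ B · [C₁]^N` in `T(ℂ)`.
[cite: BurgisserClausenShokrollahi1997, (14.21)] -/
theorem amortised_iff_le (N B m : ℕ) :
    TensorRestrictsTo (kroneckerTensor (unitTensor ℂ B) (kroneckerPow coupling₁ N))
        (kroneckerTensor (unitTensor ℂ m) (kroneckerPow (matMulTensor ℂ 2 2 2) N)) ↔
      (m : TensorClass ℂ) * TensorClass.mk (matMulTensor ℂ 2 2 2) ^ N ≤
        (B : TensorClass ℂ) * TensorClass.mk coupling₁ ^ N := by
  rw [← mk_unit_kronecker_pow, ← mk_unit_kronecker_pow, TensorClass.mk_le_mk_iff]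

/-- Multiplicity one is the exchange number: `⟨B⟩ ⊠ C₁^{⊠N} ⊵ ⟨1⟩ ⊠ M^{⊠N} ⟺ Helped N B`.
[cite: CoppersmithWinograd1990, §7] -/
theorem restrictsTo_unitOne_iff_helped (N B : ℕ) :
    TensorRestrictsTo (kroneckerTensor (unitTensor ℂ B) (kroneckerPow coupling₁ N))
        (kroneckerTensor (unitTensor ℂ 1) (kroneckerPow (matMulTensor ℂ 2 2 2) N)) ↔
      Helped N B := by
  rw [amortised_iff_le, helped_iff_le, Nat.cast_one, one_mul]

/-- Amortised certificates multiply: `(N, B, m)` and `(N', B', m')` give `(N + N', B B', m m')`.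
[cite: BurgisserClausenShokrollahi1997, (14.21)] -/
theorem amortised_mul {N N' B B' m m' : ℕ}
    (h : TensorRestrictsTo (kroneckerTensor (unitTensor ℂ B) (kroneckerPow coupling₁ N))
      (kroneckerTensor (unitTensor ℂ m) (kroneckerPow (matMulTensor ℂ 2 2 2) N)))
    (h' : TensorRestrictsTo (kroneckerTensor (unitTensor ℂ B') (kroneckerPow coupling₁ N'))
      (kroneckerTensor (unitTensor ℂ m') (kroneckerPow (matMulTensor ℂ 2 2 2) N'))) :
    TensorRestrictsTo (kroneckerTensor (unitTensor ℂ (B * B')) (kroneckerPow coupling₁ (N + N')))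
      (kroneckerTensor (unitTensor ℂ (m * m')) (kroneckerPow (matMulTensor ℂ 2 2 2) (N + N'))) := by
  rw [amortised_iff_le] at h h' ⊢
  have := TensorClass.mul_le_mul h h'
  push_cast
  calc (m : TensorClass ℂ) * m' * TensorClass.mk (matMulTensor ℂ 2 2 2) ^ (N + N')
      = (m : TensorClass ℂ) * TensorClass.mk (matMulTensor ℂ 2 2 2) ^ N *
          ((m' : TensorClass ℂ) * TensorClass.mk (matMulTensor ℂ 2 2 2) ^ N') := by ring
    _ ≤ (B : TensorClass ℂ) * TensorClass.mk coupling₁ ^ N *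
          ((B' : TensorClass ℂ) * TensorClass.mk coupling₁ ^ N') := this
    _ = (B : TensorClass ℂ) * B' * TensorClass.mk coupling₁ ^ (N + N') := by ring

/-- Powers of an amortised certificate: `(N, B, m)` gives `(k N, B^k, m^k)`. [cite: BurgisserClausenShokrollahi1997, (14.21)] -/
theorem amortised_pow {N B m : ℕ}
    (h : TensorRestrictsTo (kroneckerTensor (unitTensor ℂ B) (kroneckerPow coupling₁ N))
      (kroneckerTensor (unitTensor ℂ m) (kroneckerPow (matMulTensor ℂ 2 2 2) N))) (k : ℕ) :
    TensorRestrictsTo (kroneckerTensor (unitTensor ℂ (B ^ k)) (kroneckerPow coupling₁ (k * N)))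
      (kroneckerTensor (unitTensor ℂ (m ^ k)) (kroneckerPow (matMulTensor ℂ 2 2 2) (k * N))) := by
  induction k with
  | zero =>
    rw [amortised_iff_le]
    simp
  | succ k ih =>
    have := amortised_mul ih h
    rwa [← pow_succ, ← pow_succ, ← Nat.succ_mul] at this

/-- The level-one datum with multiplicity, iterated: `⟨3^k⟩ ⊠ C₁^{⊠k} ⊵ ⟨2^k⟩ ⊠ ⟨2,2,2⟩^{⊠k}`.
[cite: CoppersmithWinograd1990, §7] -/
theorem amortised_three_pow_two_pow (k : ℕ) :
    TensorRestrictsTo (kroneckerTensor (unitTensor ℂ (3 ^ k)) (kroneckerPow coupling₁ k))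
      (kroneckerTensor (unitTensor ℂ (2 ^ k)) (kroneckerPow (matMulTensor ℂ 2 2 2) k)) := by
  have h := amortised_pow OutsiderSandwichYield.unitThree_coupling₁_restrictsTo_unitTwo_matMul k
  rwa [mul_one] at h

/-! ## 2. Spectral value of an amortised certificate -/

/-- At a universal point an amortised degeneration certificate reads `m · F⟨2,2,2⟩^N ≤ B · F(C₁)^N`.
[cite: Strassen1988, Thm. 3.8] -/
theorem spectral_of_amortised {N B m : ℕ}
    (h : AlgDegeneratesTo (kroneckerTensor (unitTensor ℂ B) (kroneckerPow coupling₁ N))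
      (kroneckerTensor (unitTensor ℂ m) (kroneckerPow (matMulTensor ℂ 2 2 2) N)))
    {F : SpectralMap ℂ} (hF : IsUniversalSpectralPoint ℂ F) :
    (m : ℝ) * F (matMulTensor ℂ 2 2 2) ^ N ≤ B * F coupling₁ ^ N := by
  have key := hF.mono_of_algDegeneratesTo h
  rw [hF.map_kronecker, hF.map_kronecker, hF.map_kroneckerPow, hF.map_kroneckerPow,
    hF.map_unitTensor, hF.map_unitTensor] at key
  exact key

/-- An amortised certificate with `N, m ≥ 1` forces `B ≥ 1` (indeed `B ≥ m`, by the flattening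
count; positivity is all that is used below). [cite: Strassen1988, Thm. 3.8] -/
theorem pos_of_amortised {N B m : ℕ} (hm : 0 < m)
    (h : AlgDegeneratesTo (kroneckerTensor (unitTensor ℂ B) (kroneckerPow coupling₁ N))
      (kroneckerTensor (unitTensor ℂ m) (kroneckerPow (matMulTensor ℂ 2 2 2) N))) :
    0 < B := by
  have hF := (gaugePoint_isUniversalSpectralPoint_holds ℂ).1
  have key := spectral_of_amortised h hF
  have hM : (0 : ℝ) < gaugePoint₁ ℂ (matMulTensor ℂ 2 2 2) :=
    lt_of_lt_of_le (by norm_num) (OutsiderSandwichEdgeRigidity.four_le_map_matMulTensor_two hF)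
  have hlhs : (0 : ℝ) < (m : ℝ) * gaugePoint₁ ℂ (matMulTensor ℂ 2 2 2) ^ N := by positivity
  by_contra hB
  have hB0 : B = 0 := by omega
  subst hB0
  simp at key
  linarith

/-- **Amortised certificates bound the spectral ratio**: `⟨B⟩ ⊠ C₁^{⊠N} ⊵ ⟨m⟩ ⊠ ⟨2,2,2⟩^{⊠N}`
(`N, m ≥ 1`, degeneration suffices) gives `F⟨2,2,2⟩ ≤ 2^{log₂(B/m)/N} F(C₁)` at every universal
point. [cite: Strassen1988, Thm. 3.8] -/
theorem spectralRatioLe_of_amortised {N B m : ℕ} (hN : 0 < N) (hm : 0 < m)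
    (h : AlgDegeneratesTo (kroneckerTensor (unitTensor ℂ B) (kroneckerPow coupling₁ N))
      (kroneckerTensor (unitTensor ℂ m) (kroneckerPow (matMulTensor ℂ 2 2 2) N))) :
    SpectralRatioLe (Real.logb 2 ((B : ℝ) / m) / N) := by
  intro F hF
  have key := spectral_of_amortised h hF
  have hB : 0 < B := pos_of_amortised hm h
  set a := F (matMulTensor ℂ 2 2 2) with ha
  set c := F coupling₁ with hc
  have ha0 : 0 ≤ a := le_trans (by norm_num) (OutsiderSandwichEdgeRigidity.four_le_map_matMulTensor_two hF)
  have hc0 : 0 ≤ c := le_trans (by norm_num) (four_le_map_coupling₁ hF)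
  have hρ : (0 : ℝ) < (B : ℝ) / m := by positivity
  -- `2^{log₂ ρ / N} = ρ^{1/N}`
  have hexp : (2 : ℝ) ^ (Real.logb 2 ((B : ℝ) / m) / N) = ((B : ℝ) / m) ^ ((N : ℝ)⁻¹) := by
    rw [div_eq_mul_inv, Real.rpow_mul (by norm_num : (0 : ℝ) ≤ 2),
      Real.rpow_logb (by norm_num) (by norm_num) hρ]
  rw [hexp]
  -- compare `N`-th powers
  have hN0 : N ≠ 0 := Nat.pos_iff_ne_zero.mp hN
  refine le_of_pow_le_pow_left₀ hN0 (by positivity) ?_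
  rw [mul_pow, Real.rpow_inv_natCast_pow hρ.le hN0]
  have hm' : (0 : ℝ) < m := by exact_mod_cast hm
  rw [div_mul_eq_mul_div, le_div_iff₀ hm']
  linarith [key]

/-- **`θ⋆ ≤ log₂(B/m)/N`** for every amortised certificate (`N, m ≥ 1`): the amortised ratio `B/m`
bounds the exchange exponent. [cite: Strassen1988, Thm. 3.8] -/
theorem exchangeExponent_le_of_amortised {N B m : ℕ} (hN : 0 < N) (hm : 0 < m)
    (h : AlgDegeneratesTo (kroneckerTensor (unitTensor ℂ B) (kroneckerPow coupling₁ N))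
      (kroneckerTensor (unitTensor ℂ m) (kroneckerPow (matMulTensor ℂ 2 2 2) N))) :
    exchangeExponent ≤ Real.logb 2 ((B : ℝ) / m) / N :=
  exchangeExponent_le_of_spectralRatioLe (spectralRatioLe_of_amortised hN hm h)

/-- Restriction version of `exchangeExponent_le_of_amortised`. [cite: Strassen1988, Thm. 3.8] -/
theorem exchangeExponent_le_of_amortised_restrictsTo {N B m : ℕ} (hN : 0 < N) (hm : 0 < m)
    (h : TensorRestrictsTo (kroneckerTensor (unitTensor ℂ B) (kroneckerPow coupling₁ N))
      (kroneckerTensor (unitTensor ℂ m) (kroneckerPow (matMulTensor ℂ 2 2 2) N))) :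
    exchangeExponent ≤ Real.logb 2 ((B : ℝ) / m) / N :=
  exchangeExponent_le_of_amortised hN hm h.algDegeneratesTo

/-! ## 3. Tight amortisation decides the leaf -/

/-- **A tight amortised certificate at any single level decides the leaf**: if
`⟨m⟩ ⊠ C₁^{⊠N}` degenerates to `⟨m⟩ ⊠ ⟨2,2,2⟩^{⊠N}` for some `N, m ≥ 1`, then `BlockOneIsMM`.
[cite: Strassen1988, Thm. 3.8] -/
theorem blockOneIsMM_of_tight {N m : ℕ} (hN : 0 < N) (hm : 0 < m)
    (h : AlgDegeneratesTo (kroneckerTensor (unitTensor ℂ m) (kroneckerPow coupling₁ N))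
      (kroneckerTensor (unitTensor ℂ m) (kroneckerPow (matMulTensor ℂ 2 2 2) N))) :
    Theses.OutsiderSandwich.BlockOneIsMM := by
  rw [blockOneIsMM_iff_spectralRatioLe_zero]
  have key := spectralRatioLe_of_amortised hN hm h
  have hm' : (m : ℝ) ≠ 0 := by exact_mod_cast hm.ne'
  rwa [div_self hm', Real.logb_one, zero_div] at key

/-- Restriction version of `blockOneIsMM_of_tight`. [cite: Strassen1988, Thm. 3.8] -/
theorem blockOneIsMM_of_tight_restrictsTo {N m : ℕ} (hN : 0 < N) (hm : 0 < m)
    (h : TensorRestrictsTo (kroneckerTensor (unitTensor ℂ m) (kroneckerPow coupling₁ N))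
      (kroneckerTensor (unitTensor ℂ m) (kroneckerPow (matMulTensor ℂ 2 2 2) N))) :
    Theses.OutsiderSandwich.BlockOneIsMM :=
  blockOneIsMM_of_tight hN hm h.algDegeneratesTo

/-- The multiplicity-one tight case is Kernel II: `⟨1⟩ ⊠ C₁^{⊠N} ⋭ ⟨1⟩ ⊠ ⟨2,2,2⟩^{⊠N}` (`N ≥ 1`).
[cite: CoppersmithWinograd1990, §7] -/
theorem not_tight_one {N : ℕ} (hN : 1 ≤ N) :
    ¬ TensorRestrictsTo (kroneckerTensor (unitTensor ℂ 1) (kroneckerPow coupling₁ N))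
      (kroneckerTensor (unitTensor ℂ 1) (kroneckerPow (matMulTensor ℂ 2 2 2) N)) := by
  rw [restrictsTo_unitOne_iff_helped]
  exact not_helped_one hN

/-- The level-one amortised datum in exponent form: `θ⋆ ≤ log₂(3/2)` from `⟨3⟩ ⊠ C₁ ⊵ ⟨2⟩ ⊠ ⟨2,2,2⟩`
(weaker than `θ⋆ ≤ 1/2` from `r(2) = 2`, recorded as the first rung of the amortised ladder).
[cite: CoppersmithWinograd1990, §7] -/
theorem exchangeExponent_le_logb_three_halves : exchangeExponent ≤ Real.logb 2 (3 / 2) := by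
  have h := exchangeExponent_le_of_amortised_restrictsTo one_pos two_pos
    OutsiderSandwichYield.unitThree_coupling₁_restrictsTo_unitTwo_matMul
  norm_num at h
  exact h

end Summit.MatrixMultiplication.MatrixMultiplication.Theorems.OutsiderSandwichAmortised
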